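import Mathlib
import Summits.KontsevichZagierPeriods.Zeta5Search.Elimination.DictBridgeLevelOneClusters
import HarnessLib

/-!
# gen-1's bridge at the level-`1` cluster `(1;1,0,0,0,0,0,0)` (E-L22d; fam-elim gen 24)

HONEST FRAMING: systematic search; no irrationality claim unless certified — identities among the rational Taylor
data `U, V, W` of the Ball–Rivoal family and gen-1's dictionary values `(Q, P̂, P)`; nothing about sizes/irrationality.

OUR work (Summit side; `families/elim/FAMILY.md` §17).  PROOF of the node `DictBridgeClusterThree` of
`Elimination/DictBridgeLevelOneClusters`: gen-1's four-term relation `DictBridge` at the ONE bridge cluster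
`{c, c+e₇, Hc, DSc}` with base `c = bOfA a = (1;1,0,0,0,0,0,0)`.  Method = EXPLICIT EVALUATION (gen-1's
`WedgeDictionaryCorner` §4 pattern): at each of the seven dual points `c, c+e₇, c+2e₇, Hc, Hc+e₇, DSc, DSc+e₇` an explicit
partial-fraction table is certified (`IsPFData`, one `field_simp; ring` each), giving `U, W, V` (`coeffU_eq`, `coeffW_eq`,
`coeffV_eq`) and the slot-`7` Casoratians `U∧W, U∧V, V∧W` at the four cluster points; the three gauge ratios
(`rhoB_bump6`, `rhoB_hShift`, `rhoB_dsShift`, all valid at level `1`) express `ρ` at `c+e₇, Hc, DSc` as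
`-2, -8, -1` times `ρ(c)`; with `dict_values` each bridge row is then `ρ(c)·0 = 0`.
Values: `(U,W,V)(c) = (2,10,14)`, `(c+e₇) = (0,-4,-5)`,
`(Hc) = (2,4,55/8)`, `(DSc) = (-4,-24,-33)`; bridge coefficients
`(α,β,γ,δ) = (2,-1,2,2)`.
What this is NOT: the other two clusters are separate files; nothing about sizes, denominators or irrationality; the
class verdict is unchanged (T1 NO / T2 NO / T4 YES).
-/

open Finset Polynomial

namespace Summit.KontsevichZagierPeriods.Zeta5Search.Elimination

open Summit.KontsevichZagierPeriods.Zeta5Search.DualSeries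
open Summit.KontsevichZagierPeriods.Zeta5Search.WedgeDictionary
open Summit.KontsevichZagierPeriods.Zeta5Search.SymmetricGauge
open Literature.NumberTheory.Irrationality.BrownZudilin2022 (bOfA)
open Literature.NumberTheory.Transcendental.BallRivoal (pfEval harm poch)

/-! ### 1. The seven dual points of the cluster -/

/-- The point `c+e₇` = `(1;1,0,0,0,0,0,1)`. -/
def k3P1 : ℕ → ℤ := fun j =>
  if j = 0 then 1 else if j = 1 then 1 else if j = 7 then 1 else 0

/-- The point `c+2e₇` = `(1;1,0,0,0,0,0,2)`. -/
def k3P2 : ℕ → ℤ := fun j =>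
  if j = 0 then 1 else if j = 1 then 1 else if j = 7 then 2 else 0

/-- The point `Hc` = `(2;1,0,0,1,1,0,1)`. -/
def k3P3 : ℕ → ℤ := fun j =>
  if j = 0 then 2 else if j = 1 then 1 else if j = 4 then 1 else if j = 5 then 1 else if j = 7 then 1 else 0

/-- The point `Hc+e₇` = `(2;1,0,0,1,1,0,2)`. -/
def k3P4 : ℕ → ℤ := fun j =>
  if j = 0 then 2 else if j = 1 then 1 else if j = 4 then 1 else if j = 5 then 1 else if j = 7 then 2 else 0

/-- The point `DSc` = `(3;2,1,1,1,1,1,1)` (slots `≥ 8` carry `1`, matching `dsShift`). -/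
def k3P5 : ℕ → ℤ := fun j =>
  if j = 0 then 3 else if j = 1 then 2 else 1

/-- The point `DSc+e₇` = `(3;2,1,1,1,1,1,2)` (slots `≥ 8` carry `1`, matching `dsShift`). -/
def k3P6 : ℕ → ℤ := fun j =>
  if j = 0 then 3 else if j = 1 then 2 else if j = 7 then 2 else 1

/-- The six shift identities between the seven points (as functions on `ℕ`). -/
theorem k3_shifts : bump kThree 6 = k3P1 ∧ bump k3P1 6 = k3P2 ∧ hShift kThree = k3P3 ∧
    bump k3P3 6 = k3P4 ∧ dsShift kThree = k3P5 ∧ bump k3P5 6 = k3P6 := by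
  refine ⟨?_, ?_, ?_, ?_, ?_, ?_⟩ <;> funext j <;> rcases j with _ | _ | _ | _ | _ | _ | _ | _ | j <;>
    simp [bump, hShift, dsShift, kThree, k3P1, k3P2, k3P3, k3P4, k3P5, k3P6]

/-- The base is in the box, with `d = 2`. -/
theorem k3_inBox : InBox kThree ∧ dOf kThree = 2 := by
  refine ⟨⟨by decide, fun j hj => ?_⟩, ?_⟩
  · have := mem_range.1 hj
    interval_cases j <;> decide
  · unfold dOf
    simp only [sum_range_succ, sum_range_zero, kThree]
    norm_num

/-! ### 2. Seven explicit partial-fraction certificates and the values `U, W, V` -/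

/-- Evaluation of the shifted numerator `numPoly_b(t+1)`. -/
theorem k3_evalNum (b : ℕ → ℤ) (t : ℚ) : ((numPoly b).comp (X + C 1)).eval t =
    (2 * (t + 1) + (b 0 : ℚ)) * ∏ j ∈ range 7, (poch (t + 1) (b (j + 1)).toNat *
      poch (t + 1 + ((b 0 - b (j + 1) + 1 : ℤ) : ℚ)) (b (j + 1)).toNat) := by
  rw [eval_comp, eval_add, eval_X, eval_C, eval_numPoly]

/-- Partial-fraction table of `R_b`, `b = kThree` (non-zero entries `c_{o,p}`). -/
def k3T0 : ℕ → ℕ → ℚ := fun o p =>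
  if o = 1 ∧ p = 0 then (-5 : ℚ) else if o = 1 ∧ p = 1 then 5 else if o = 2 ∧ p = 0 then 5 else
  if o = 2 ∧ p = 1 then 5 else if o = 3 ∧ p = 0 then (-3 : ℚ) else if o = 3 ∧ p = 1 then 3 else
  if o = 4 ∧ p = 0 then 1 else if o = 4 ∧ p = 1 then 1 else 0

/-- `k3T0` is the partial-fraction data at `kThree`. -/
theorem k3_cert0 : IsPFData kThree k3T0 := by
  intro t ht
  have hB : (kThree 0).toNat = 1 := by decide
  rw [hB] at ht ⊢
  have h1 : t + 1 ≠ 0 := by have := ht 0 (by norm_num); intro h; apply this; push_cast; linarith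
  have h2 : t + 2 ≠ 0 := by have := ht 1 (by norm_num); intro h; apply this; push_cast; linarith
  rw [k3_evalNum]
  simp only [pfEval, sum_range_succ, sum_range_zero, prod_range_succ, prod_range_zero, k3T0, kThree, poch]
  norm_num [add_assoc]
  field_simp
  ring

/-- `(U, W, V)` at `kThree` = `(2, 10, 14)`. -/
theorem k3_vals0 : coeffU kThree = 2 ∧ coeffW kThree = 10 ∧ coeffV kThree = 14 := by
  have hB : (kThree 0).toNat = 1 := by decide
  refine ⟨?_, ?_, ?_⟩
  · rw [coeffU_eq k3_cert0, hB]; simp only [sum_range_succ, sum_range_zero, k3T0]; norm_num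
  · rw [coeffW_eq k3_cert0, hB]; simp only [sum_range_succ, sum_range_zero, k3T0]; norm_num
  · rw [coeffV_eq k3_cert0, hB]; simp only [sum_range_succ, sum_range_zero, k3T0, harm]; norm_num

/-- Partial-fraction table of `R_b`, `b = k3P1` (non-zero entries `c_{o,p}`). -/
def k3T1 : ℕ → ℕ → ℚ := fun o p =>
  if o = 1 ∧ p = 0 then 2 else if o = 1 ∧ p = 1 then (-2 : ℚ) else if o = 2 ∧ p = 0 then (-2 : ℚ) else
  if o = 2 ∧ p = 1 then (-2 : ℚ) else if o = 3 ∧ p = 0 then 1 else if o = 3 ∧ p = 1 then (-1 : ℚ) else 0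

/-- `k3T1` is the partial-fraction data at `k3P1`. -/
theorem k3_cert1 : IsPFData k3P1 k3T1 := by
  intro t ht
  have hB : (k3P1 0).toNat = 1 := by decide
  rw [hB] at ht ⊢
  have h1 : t + 1 ≠ 0 := by have := ht 0 (by norm_num); intro h; apply this; push_cast; linarith
  have h2 : t + 2 ≠ 0 := by have := ht 1 (by norm_num); intro h; apply this; push_cast; linarith
  rw [k3_evalNum]
  simp only [pfEval, sum_range_succ, sum_range_zero, prod_range_succ, prod_range_zero, k3T1, k3P1, poch]
  norm_num [add_assoc]
  field_simp
  ring

/-- `(U, W, V)` at `k3P1` = `(0, -4, -5)`. -/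
theorem k3_vals1 : coeffU k3P1 = 0 ∧ coeffW k3P1 = (-4 : ℚ) ∧ coeffV k3P1 = (-5 : ℚ) := by
  have hB : (k3P1 0).toNat = 1 := by decide
  refine ⟨?_, ?_, ?_⟩
  · rw [coeffU_eq k3_cert1, hB]; simp only [sum_range_succ, sum_range_zero, k3T1]; norm_num
  · rw [coeffW_eq k3_cert1, hB]; simp only [sum_range_succ, sum_range_zero, k3T1]; norm_num
  · rw [coeffV_eq k3_cert1, hB]; simp only [sum_range_succ, sum_range_zero, k3T1, harm]; norm_num

/-- Partial-fraction table of `R_b`, `b = k3P2` (non-zero entries `c_{o,p}`). -/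
def k3T2 : ℕ → ℕ → ℚ := fun o p =>
  if o = 1 ∧ p = 0 then (-1 : ℚ) else if o = 1 ∧ p = 1 then 1 else if o = 2 ∧ p = 0 then 1 else
  if o = 2 ∧ p = 1 then 1 else 0

/-- `k3T2` is the partial-fraction data at `k3P2`. -/
theorem k3_cert2 : IsPFData k3P2 k3T2 := by
  intro t ht
  have hB : (k3P2 0).toNat = 1 := by decide
  rw [hB] at ht ⊢
  have h1 : t + 1 ≠ 0 := by have := ht 0 (by norm_num); intro h; apply this; push_cast; linarith
  have h2 : t + 2 ≠ 0 := by have := ht 1 (by norm_num); intro h; apply this; push_cast; linarith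
  rw [k3_evalNum]
  simp only [pfEval, sum_range_succ, sum_range_zero, prod_range_succ, prod_range_zero, k3T2, k3P2, poch]
  norm_num [add_assoc, prod_range_succ, prod_range_zero, show (2 : ℤ).toNat = 2 from rfl]
  field_simp
  ring

/-- `(U, W, V)` at `k3P2` = `(0, 2, 2)`. -/
theorem k3_vals2 : coeffU k3P2 = 0 ∧ coeffW k3P2 = 2 ∧ coeffV k3P2 = 2 := by
  have hB : (k3P2 0).toNat = 1 := by decide
  refine ⟨?_, ?_, ?_⟩
  · rw [coeffU_eq k3_cert2, hB]; simp only [sum_range_succ, sum_range_zero, k3T2]; norm_num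
  · rw [coeffW_eq k3_cert2, hB]; simp only [sum_range_succ, sum_range_zero, k3T2]; norm_num
  · rw [coeffV_eq k3_cert2, hB]; simp only [sum_range_succ, sum_range_zero, k3T2, harm]; norm_num

/-- Partial-fraction table of `R_b`, `b = k3P3` (non-zero entries `c_{o,p}`). -/
def k3T3 : ℕ → ℕ → ℚ := fun o p =>
  if o = 0 ∧ p = 0 then (-3 : ℚ) else if o = 0 ∧ p = 1 then 6 else if o = 0 ∧ p = 2 then (-3 : ℚ) else
  if o = 1 ∧ p = 0 then 1 / 2 else if o = 1 ∧ p = 2 then (-1 : ℚ) / 2 else if o = 2 ∧ p = 1 then 4 else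
  if o = 4 ∧ p = 1 then 2 else 0

/-- `k3T3` is the partial-fraction data at `k3P3`. -/
theorem k3_cert3 : IsPFData k3P3 k3T3 := by
  intro t ht
  have hB : (k3P3 0).toNat = 2 := by decide
  rw [hB] at ht ⊢
  have h1 : t + 1 ≠ 0 := by have := ht 0 (by norm_num); intro h; apply this; push_cast; linarith
  have h2 : t + 2 ≠ 0 := by have := ht 1 (by norm_num); intro h; apply this; push_cast; linarith
  have h3 : t + 3 ≠ 0 := by have := ht 2 (by norm_num); intro h; apply this; push_cast; linarith
  rw [k3_evalNum]
  simp only [pfEval, sum_range_succ, sum_range_zero, prod_range_succ, prod_range_zero, k3T3, k3P3, poch]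
  norm_num [add_assoc]
  field_simp
  ring

/-- `(U, W, V)` at `k3P3` = `(2, 4, 55/8)`. -/
theorem k3_vals3 : coeffU k3P3 = 2 ∧ coeffW k3P3 = 4 ∧ coeffV k3P3 = 55 / 8 := by
  have hB : (k3P3 0).toNat = 2 := by decide
  refine ⟨?_, ?_, ?_⟩
  · rw [coeffU_eq k3_cert3, hB]; simp only [sum_range_succ, sum_range_zero, k3T3]; norm_num
  · rw [coeffW_eq k3_cert3, hB]; simp only [sum_range_succ, sum_range_zero, k3T3]; norm_num
  · rw [coeffV_eq k3_cert3, hB]; simp only [sum_range_succ, sum_range_zero, k3T3, harm]; norm_num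

/-- Partial-fraction table of `R_b`, `b = k3P4` (non-zero entries `c_{o,p}`). -/
def k3T4 : ℕ → ℕ → ℚ := fun o p =>
  if o = 0 ∧ p = 0 then (-2 : ℚ) else if o = 0 ∧ p = 1 then 4 else if o = 0 ∧ p = 2 then (-2 : ℚ) else
  if o = 1 ∧ p = 0 then 1 / 2 else if o = 1 ∧ p = 2 then (-1 : ℚ) / 2 else if o = 2 ∧ p = 1 then 2 else 0

/-- `k3T4` is the partial-fraction data at `k3P4`. -/
theorem k3_cert4 : IsPFData k3P4 k3T4 := by
  intro t ht
  have hB : (k3P4 0).toNat = 2 := by decide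
  rw [hB] at ht ⊢
  have h1 : t + 1 ≠ 0 := by have := ht 0 (by norm_num); intro h; apply this; push_cast; linarith
  have h2 : t + 2 ≠ 0 := by have := ht 1 (by norm_num); intro h; apply this; push_cast; linarith
  have h3 : t + 3 ≠ 0 := by have := ht 2 (by norm_num); intro h; apply this; push_cast; linarith
  rw [k3_evalNum]
  simp only [pfEval, sum_range_succ, sum_range_zero, prod_range_succ, prod_range_zero, k3T4, k3P4, poch]
  norm_num [add_assoc, prod_range_succ, prod_range_zero, show (2 : ℤ).toNat = 2 from rfl]
  field_simp
  ring

/-- `(U, W, V)` at `k3P4` = `(0, 2, 19/8)`. -/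
theorem k3_vals4 : coeffU k3P4 = 0 ∧ coeffW k3P4 = 2 ∧ coeffV k3P4 = 19 / 8 := by
  have hB : (k3P4 0).toNat = 2 := by decide
  refine ⟨?_, ?_, ?_⟩
  · rw [coeffU_eq k3_cert4, hB]; simp only [sum_range_succ, sum_range_zero, k3T4]; norm_num
  · rw [coeffW_eq k3_cert4, hB]; simp only [sum_range_succ, sum_range_zero, k3T4]; norm_num
  · rw [coeffV_eq k3_cert4, hB]; simp only [sum_range_succ, sum_range_zero, k3T4, harm]; norm_num

/-- Partial-fraction table of `R_b`, `b = k3P5` (non-zero entries `c_{o,p}`). -/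
def k3T5 : ℕ → ℕ → ℚ := fun o p =>
  if o = 1 ∧ p = 1 then 12 else if o = 1 ∧ p = 2 then (-12 : ℚ) else if o = 2 ∧ p = 1 then (-12 : ℚ) else
  if o = 2 ∧ p = 2 then (-12 : ℚ) else if o = 3 ∧ p = 1 then 7 else if o = 3 ∧ p = 2 then (-7 : ℚ) else
  if o = 4 ∧ p = 1 then (-2 : ℚ) else if o = 4 ∧ p = 2 then (-2 : ℚ) else 0

/-- `k3T5` is the partial-fraction data at `k3P5`. -/
theorem k3_cert5 : IsPFData k3P5 k3T5 := by
  intro t ht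
  have hB : (k3P5 0).toNat = 3 := by decide
  rw [hB] at ht ⊢
  have h1 : t + 1 ≠ 0 := by have := ht 0 (by norm_num); intro h; apply this; push_cast; linarith
  have h2 : t + 2 ≠ 0 := by have := ht 1 (by norm_num); intro h; apply this; push_cast; linarith
  have h3 : t + 3 ≠ 0 := by have := ht 2 (by norm_num); intro h; apply this; push_cast; linarith
  have h4 : t + 4 ≠ 0 := by have := ht 3 (by norm_num); intro h; apply this; push_cast; linarith
  rw [k3_evalNum]
  simp only [pfEval, sum_range_succ, sum_range_zero, prod_range_succ, prod_range_zero, k3T5, k3P5, poch]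
  norm_num [add_assoc, prod_range_succ, prod_range_zero, show (2 : ℤ).toNat = 2 from rfl]
  field_simp
  ring

/-- `(U, W, V)` at `k3P5` = `(-4, -24, -33)`. -/
theorem k3_vals5 : coeffU k3P5 = (-4 : ℚ) ∧ coeffW k3P5 = (-24 : ℚ) ∧ coeffV k3P5 = (-33 : ℚ) := by
  have hB : (k3P5 0).toNat = 3 := by decide
  refine ⟨?_, ?_, ?_⟩
  · rw [coeffU_eq k3_cert5, hB]; simp only [sum_range_succ, sum_range_zero, k3T5]; norm_num
  · rw [coeffW_eq k3_cert5, hB]; simp only [sum_range_succ, sum_range_zero, k3T5]; norm_num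
  · rw [coeffV_eq k3_cert5, hB]; simp only [sum_range_succ, sum_range_zero, k3T5, harm]; norm_num

/-- Partial-fraction table of `R_b`, `b = k3P6` (non-zero entries `c_{o,p}`). -/
def k3T6 : ℕ → ℕ → ℚ := fun o p =>
  if o = 1 ∧ p = 1 then (-5 : ℚ) else if o = 1 ∧ p = 2 then 5 else if o = 2 ∧ p = 1 then 5 else
  if o = 2 ∧ p = 2 then 5 else if o = 3 ∧ p = 1 then (-2 : ℚ) else if o = 3 ∧ p = 2 then 2 else 0

/-- `k3T6` is the partial-fraction data at `k3P6`. -/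
theorem k3_cert6 : IsPFData k3P6 k3T6 := by
  intro t ht
  have hB : (k3P6 0).toNat = 3 := by decide
  rw [hB] at ht ⊢
  have h1 : t + 1 ≠ 0 := by have := ht 0 (by norm_num); intro h; apply this; push_cast; linarith
  have h2 : t + 2 ≠ 0 := by have := ht 1 (by norm_num); intro h; apply this; push_cast; linarith
  have h3 : t + 3 ≠ 0 := by have := ht 2 (by norm_num); intro h; apply this; push_cast; linarith
  have h4 : t + 4 ≠ 0 := by have := ht 3 (by norm_num); intro h; apply this; push_cast; linarith
  rw [k3_evalNum]
  simp only [pfEval, sum_range_succ, sum_range_zero, prod_range_succ, prod_range_zero, k3T6, k3P6, poch]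
  norm_num [add_assoc, prod_range_succ, prod_range_zero, show (2 : ℤ).toNat = 2 from rfl]
  field_simp
  ring

/-- `(U, W, V)` at `k3P6` = `(0, 10, 12)`. -/
theorem k3_vals6 : coeffU k3P6 = 0 ∧ coeffW k3P6 = 10 ∧ coeffV k3P6 = 12 := by
  have hB : (k3P6 0).toNat = 3 := by decide
  refine ⟨?_, ?_, ?_⟩
  · rw [coeffU_eq k3_cert6, hB]; simp only [sum_range_succ, sum_range_zero, k3T6]; norm_num
  · rw [coeffW_eq k3_cert6, hB]; simp only [sum_range_succ, sum_range_zero, k3T6]; norm_num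
  · rw [coeffV_eq k3_cert6, hB]; simp only [sum_range_succ, sum_range_zero, k3T6, harm]; norm_num

/-! ### 3. The twelve Casoratians of the cluster -/

/-- `(U∧W, U∧V, V∧W)` at `kThree` = `(-8, -10, -6)`. -/
theorem k3_cas0 : casUW kThree = (-8 : ℚ) ∧ casUV kThree = (-10 : ℚ) ∧ casVW kThree = (-6 : ℚ) := by
  obtain ⟨u0, w0, v0⟩ := k3_vals0
  obtain ⟨u1, w1, v1⟩ := k3_vals1
  unfold casUW casUV casVW
  rw [k3_shifts.1, u0, w0, v0, u1, w1, v1]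
  norm_num

/-- `(U∧W, U∧V, V∧W)` at `k3P1` = `(0, 0, -2)`. -/
theorem k3_cas1 : casUW k3P1 = 0 ∧ casUV k3P1 = 0 ∧ casVW k3P1 = (-2 : ℚ) := by
  obtain ⟨u0, w0, v0⟩ := k3_vals1
  obtain ⟨u1, w1, v1⟩ := k3_vals2
  unfold casUW casUV casVW
  rw [k3_shifts.2.1, u0, w0, v0, u1, w1, v1]
  norm_num

/-- `(U∧W, U∧V, V∧W)` at `k3P3` = `(4, 19/4, 17/4)`. -/
theorem k3_cas3 : casUW k3P3 = 4 ∧ casUV k3P3 = 19 / 4 ∧ casVW k3P3 = 17 / 4 := by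
  obtain ⟨u0, w0, v0⟩ := k3_vals3
  obtain ⟨u1, w1, v1⟩ := k3_vals4
  unfold casUW casUV casVW
  rw [k3_shifts.2.2.2.1, u0, w0, v0, u1, w1, v1]
  norm_num

/-- `(U∧W, U∧V, V∧W)` at `k3P5` = `(-40, -48, -42)`. -/
theorem k3_cas5 : casUW k3P5 = (-40 : ℚ) ∧ casUV k3P5 = (-48 : ℚ) ∧ casVW k3P5 = (-42 : ℚ) := by
  obtain ⟨u0, w0, v0⟩ := k3_vals5
  obtain ⟨u1, w1, v1⟩ := k3_vals6
  unfold casUW casUV casVW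
  rw [k3_shifts.2.2.2.2.2, u0, w0, v0, u1, w1, v1]
  norm_num

/-! ### 4. The bridge at the cluster -/

/-- **PROOF of the node `DictBridgeClusterThree`.** -/
theorem dictBridgeClusterThree_holds : DictBridgeClusterThree := by
  intro a j₀ j₁ j₂ j₃ hk H₀ H₁ H₂ H₃
  obtain ⟨hQ0, hPh0, hP0⟩ := dict_values H₀
  obtain ⟨hQ1, hPh1, hP1⟩ := dict_values H₁
  obtain ⟨hQ2, hPh2, hP2⟩ := dict_values H₂
  obtain ⟨hQ3, hPh3, hP3⟩ := dict_values H₃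
  obtain ⟨e0, -, eh, -, ed, -⟩ := k3_shifts
  -- the dual coordinates of the four points
  have h7b : ∀ j, j ≤ 7 → bOfA (a - slotDown 7) j = k3P1 j := fun j hj => by
    rw [← e0, bOfA_sub_slotDown7 a j hj]
    by_cases h : j = 7
    · rw [if_pos h, h, bump6_seven, hk 7 (by norm_num)]
    · rw [if_neg h, bump_of_ne kThree (show j ≠ 6 + 1 by omega), hk j hj]
  have hHb : ∀ j, j ≤ 7 → bOfA (a + halfUp457) j = k3P3 j := fun j hj => by
    have e : bOfA (a + halfUp457) j = hShift (bOfA a) j := by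
      rw [bOfA_add_halfUp457 a j hj]
      unfold hShift
      rfl
    rw [e, ← eh]
    simp only [hShift, hk j hj]
  have hDb : ∀ j, j ≤ 7 → bOfA (a + dsUp) j = k3P5 j := fun j hj => by
    rw [bOfA_add_dsUp a j hj, ← ed]
    simp only [dsShift, hk j hj, hk 0 (by norm_num)]
  -- the three gauge ratios at level 1
  obtain ⟨hI, hd⟩ := k3_inBox
  have R3 := rhoB_bump6 kThree hI (by decide) (by rw [hd]; norm_num) (by rw [e0]; decide)
  have R2 := rhoB_hShift kThree hI (by decide) (by decide) (by decide) (by decide) (by decide) (by decide) (by decide)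
  have R1 := rhoB_dsShift kThree hI (by rw [hd]; norm_num)
  rw [e0, hd] at R3
  rw [eh] at R2
  rw [ed, hd] at R1
  simp only [kThree, List.map_cons, List.map_nil, List.prod_cons, List.prod_nil] at R1 R2 R3
  norm_num at R1 R2 R3
  have r7 : rhoB k3P1 = (-2 : ℚ) * rhoB kThree := by linarith
  have rH : rhoB k3P3 = (-8 : ℚ) * rhoB kThree := by linarith
  have rD : rhoB k3P5 = (-1 : ℚ) * rhoB kThree := by linarith
  -- the four coefficients
  have hk0 := hk 0 (by norm_num)
  have hk1 := hk 1 (by norm_num)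
  have hk2 := hk 2 (by norm_num)
  have hk3 := hk 3 (by norm_num)
  have hk6 := hk 6 (by norm_num)
  have hk7 := hk 7 (by norm_num)
  have hα : (bridgeBase (bOfA a) : ℚ) = 2 := by
    rw [show bridgeBase (bOfA a) = 2 by unfold bridgeBase; rw [hk0, hk1, hk2, hk3, hk6, hk7]; decide]
    norm_num
  have hβ : (bridgeSlot (bOfA a) : ℚ) = (-1 : ℚ) := by
    rw [show bridgeSlot (bOfA a) = -1 by unfold bridgeSlot; rw [hk0, hk3, hk6, hk7]; decide]
    norm_num
  have hγ : (bridgeHalf (bOfA a) : ℚ) = 2 := by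
    rw [show bridgeHalf (bOfA a) = 2 by unfold bridgeHalf; rw [hk0, hk1, hk6, hk7]; decide]
    norm_num
  have hδ : (bridgeApex (bOfA a) : ℚ) = 2 := by
    rw [show bridgeApex (bOfA a) = 2 by unfold bridgeApex; rw [hk1, hk6]; decide]
    norm_num
  -- the twelve dictionary values
  obtain ⟨cUW0, cUV0, cVW0⟩ := k3_cas0
  obtain ⟨cUW1, cUV1, cVW1⟩ := k3_cas1
  obtain ⟨cUW3, cUV3, cVW3⟩ := k3_cas3
  obtain ⟨cUW5, cUV5, cVW5⟩ := k3_cas5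
  rw [rhoOf_eq_rhoB, rhoB_congr hk] at hQ0 hPh0 hP0
  rw [(cas_congr hk).1, cUW0] at hQ0
  rw [(cas_congr hk).2.1, cUV0] at hPh0
  rw [(cas_congr hk).2.2, cVW0] at hP0
  rw [rhoOf_eq_rhoB, rhoB_congr h7b, r7] at hQ1 hPh1 hP1
  rw [(cas_congr h7b).1, cUW1] at hQ1
  rw [(cas_congr h7b).2.1, cUV1] at hPh1
  rw [(cas_congr h7b).2.2, cVW1] at hP1
  rw [rhoOf_eq_rhoB, rhoB_congr hHb, rH] at hQ2 hPh2 hP2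
  rw [(cas_congr hHb).1, cUW3] at hQ2
  rw [(cas_congr hHb).2.1, cUV3] at hPh2
  rw [(cas_congr hHb).2.2, cVW3] at hP2
  rw [rhoOf_eq_rhoB, rhoB_congr hDb, rD] at hQ3 hPh3 hP3
  rw [(cas_congr hDb).1, cUW5] at hQ3
  rw [(cas_congr hDb).2.1, cUV5] at hPh3
  rw [(cas_congr hDb).2.2, cVW5] at hP3
  unfold DictFourTerm
  rw [hα, hβ, hγ, hδ, hQ0, hPh0, hP0, hQ1, hPh1, hP1, hQ2, hPh2, hP2, hQ3, hPh3, hP3]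
  refine ⟨by ring, by ring, by ring⟩

end Summit.KontsevichZagierPeriods.Zeta5Search.Elimination
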